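import Summits.HodgeConjecture.HodgeCM.Automorphic.IntegratedRep_1

/-! PORT of `HodgeCM/Automorphic/IntegratedRep.lean` (HodgeCMPerL run 82) — part 2: continuation of `Summits.HodgeConjecture.HodgeCM.Automorphic.IntegratedRep_1` (split at a top-level declaration boundary by port_pkg.py; scope re-opened below; declarations unchanged). -/

-- port_pkg: scope re-opened for this part (file-level context, then the namespace/section stack open at the cut)
set_option autoImplicit false
noncomputable section
open scoped InnerProductSpace ComplexConjugate Topology ENNReal
open MeasureTheory Filter
namespace HodgeCM
namespace RepCoreCarrier
section Koopman
variable {X : Type} [TopologicalSpace X] [R1Space X] [MeasurableSpace X] [BorelSpace X] {μ : Measure X}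
  [IsLocallyFiniteMeasure μ] [μ.InnerRegularCompactLTTop]
variable {M : Type} [Group M] [TopologicalSpace M] [MeasurableSpace M] [OpensMeasurableSpace M]
  [MulAction M X] [ContinuousSMul M X] [SMulInvariantMeasure M X μ] [MeasurableConstSMul M X]
variable {HG CG SK SigIdxG : Type}
variable [NormedAddCommGroup HG] [InnerProductSpace ℂ HG] [CompleteSpace HG]
variable [NormedAddCommGroup CG] [NormedSpace ℂ CG] [TopologicalSpace SK]
/-- Strong continuity of the Koopman representation — Mathlib (`Lp.instContinuousSMulDomMulAct`). -/
theorem stronglyContinuous_koopman : RepDecomp.StronglyContinuous (RepDecomp.koopman μ (M := M)) := by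
  haveI : Fact ((2 : ℝ≥0∞) ≠ ∞) := ⟨ENNReal.ofNat_ne_top⟩
  exact fun f => continuous_id.smul continuous_const

variable (C : RepCoreCarrier (Lp ℂ 2 μ) HG CG Mᵈᵐᵃ SK SigIdxG)

/-- **The analytic hypotheses of the core ON `L²(X, μ)` with `R` the translation representation of a continuous
measure-preserving action**: unitarity AND strong continuity are theorems; what remains is the Dirac datum with
compact `R(f_n)` (Getz–Hahn Thm 9.1.1) and the `G_U`-side completeness. -/
structure AnalyticL2D : Prop where
  /-- the representation IS the translation representation -/
  R_eq : C.R = RepDecomp.koopman μ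
  /-- compactness of the `R(f_n)` of a Dirac datum (as in `AnalyticD`) -/
  dirac_compact : ∃ d : RepDecomp.DiracDatum Mᵈᵐᵃ, ∀ n, IsCompactOperator (d.opFun C.R n)
  /-- AX1b(a) (unchanged) -/
  hatτ_complete : (⨆ j, C.hatτ j).topologicalClosure = ⊤

variable {C}

/-- (Ported verbatim from the HodgeCMPerL package; no docstring in the source.) -/
theorem AnalyticL2D.toAnalyticD (h : C.AnalyticL2D) : C.AnalyticD where
  R_unitary := by
    rw [h.R_eq]
    exact RepDecomp.isUnitaryRep_koopman
  R_continuous := by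
    rw [h.R_eq]
    exact stronglyContinuous_koopman
  dirac_compact := h.dirac_compact
  hatτ_complete := h.hatτ_complete

/-- (Ported verbatim from the HodgeCMPerL package; no docstring in the source.) -/
theorem AnalyticL2D.toAnalytic (h : C.AnalyticL2D) : C.Analytic :=
  h.toAnalyticD.toAnalytic

end Koopman

end RepCoreCarrier

end HodgeCM

end
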